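import Literature.AnabelianGeometry.SemiGraphs.CommensurableTerminalityProofs
import Literature.AnabelianGeometry.SemiGraphs.CommensurabilityProofs3
import Literature.AnabelianGeometry.SemiGraphs.CommensurabilityProofs4
import Literature.AnabelianGeometry.SemiGraphs.CoverticialHolds
import Literature.AnabelianGeometry.SemiGraphs.FiniteEtaleCoveringGlobalHolds
import Literature.AnabelianGeometry.SemiGraphs.FiniteEtaleCoveringDictionaryProofs
import Literature.AnabelianGeometry.SemiGraphs.FiniteEtaleCoveringDictionaryProofs3
import Literature.AnabelianGeometry.SemiGraphs.FiniteEtaleCoveringDictionaryProofs5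
import Literature.AnabelianGeometry.SemiGraphs.FiniteEtaleCoveringConnectedProofs

/-!
# [SemiAnbd] Cor. 2.7 (i) modulo the single dictionary item (D3) — proof

Mochizuki, *Semi-graphs of anabelioids*, Publ. RIMS **42** (2006) 221–322, Cor. 2.7 (i) p. 30
[cite: MochizukiSemiAnbd2006, Cor. 2.7(i) p.30]: for a connected, quasi-coherent semi-graph of
anabelioids which is a graph, the subgroups `Π_ℍ ≤ Π_𝒢` of connected sub-semi-graphs all of whose
vertices are elevated (in particular the verticial subgroups `Π_v` of elevated vertices) are
commensurably terminal.  abc-iut cell, layer L3, row W4-14c (bookkeeping for G28): abc-iut-L3-d3's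
reduction `corollary_2_7_i_of_dictionary` (`CommensurableTerminalityProofs.lean`) derives the typed
statement `corollary_2_7_i` (`Commensurability.lean`, abc-iut-L3-t1) from EIGHT named facts —
`proposition_2_6`, `exists_finiteEtaleCoveringGlobal` and the covering-dictionary items (D1), (D3),
(D5), (D6), (D8), (D9).  SEVEN of them are now kernel theorems:

* `proposition_2_6_holds` (abc-iut-L6-t18, `CoverticialHolds.lean`);
* `exists_finiteEtaleCoveringGlobal_holds` (abc-iut-w4-d071, `FiniteEtaleCoveringGlobalHolds.lean`,
  assembling abc-iut-L3-t5 / abc-iut-L4-t17 / abc-iut-w4-d071);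
* (D1) `covering_decompositionGroup_holds` (`FiniteEtaleCoveringDictionaryProofs.lean`),
  (D5) `covering_isQuasiCoherent_holds` and (D6) `covering_isElevated_holds`
  (`FiniteEtaleCoveringDictionaryProofs5.lean`), (D8) `covering_isConnected_holds`
  (`FiniteEtaleCoveringConnectedProofs.lean`), (D9) `covering_vertexMap_surjective_holds`
  (`FiniteEtaleCoveringDictionaryProofs3.lean`) (abc-iut-L6-d4 / L6-d5 / L4-t17 lineages).

This PROOF-ONLY file (no `def`) plugs them in: Cor. 2.7 (i) holds MODULO EXACTLY the untied
dictionary item (D3) `covering_subgraphComponents_doubleCosets` ([SemiAnbd] p. 30: connected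
components of `φ⁻¹(ℍ)` ↔ double cosets `Π_{𝒢′} \ Π_𝒢 / Π_ℍ`; holder abc-iut-L6-t17 / abc-iut-w5-d041),
which is taken as the only hypothesis; the formal consequences Rmk. 2.7.2 (abc-iut-L3-d1,
`remark_2_7_2_of_corollary_2_7_i`) and Cor. 2.7 (ii) (`corollary_2_7_ii_of_corollary_2_7_i`, which also
consumes the named fact `proposition_2_5_i`) are re-stated on the same footing, so that the residual
hypotheses of [SemiAnbd] Cor. 2.7 (i)/(ii) and Rmk. 2.7.2 in the tree are exactly {(D3)} resp.
{(D3), Prop. 2.5 (i)}.  Honest framing: conditional on (D3) (and Prop. 2.5 (i) for (ii)); typed ≠ proved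
for those; nothing here bears on [IUTchIII] Cor. 3.12.
-/

namespace Literature.AnabelianGeometry.SemiGraphs

open CategoryTheory CategoryTheory.PreGaloisCategory
open Literature.AnabelianGeometry.Anabelioids

namespace SemiGraphOfAnabelioids

universe v₁ u₁ u

/-- **[SemiAnbd] Cor. 2.7 (i), modulo (D3) alone**: commensurable terminality of `Π_ℍ` (connected
sub-semi-graphs with elevated vertices) and of `Π_v` (elevated vertices) in `Π_𝒢`, for `𝒢` connected,
quasi-coherent and a graph — from abc-iut-L3-d3's eight-fact reduction with the seven discharged facts
(`proposition_2_6_holds`, `exists_finiteEtaleCoveringGlobal_holds`, (D1), (D5), (D6), (D8), (D9))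
supplied by name; the remaining hypothesis is the dictionary item (D3).
[cite: MochizukiSemiAnbd2006, Cor. 2.7(i) p.30] -/
theorem corollary_2_7_i_of_subgraphComponents_doubleCosets
    (hD3 : covering_subgraphComponents_doubleCosets.{v₁, u₁, u}) : corollary_2_7_i.{v₁, u₁, u} :=
  corollary_2_7_i_of_dictionary proposition_2_6_holds exists_finiteEtaleCoveringGlobal_holds
    covering_decompositionGroup_holds hD3 covering_isQuasiCoherent_holds covering_isElevated_holds
    covering_isConnected_holds covering_vertexMap_surjective_holds

/-- **The sub-semi-graph engine of Cor. 2.7 (i), modulo (D3) alone**: for `𝒢` connected,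
quasi-coherent and a graph of anabelioids, `ℍ` a connected sub-graph with all vertices elevated, and any
vertex `v ∈ ℍ` with basepoint `F`, the image of `Π_ℍ → Π_𝒢` (read at `(v, F)`) is commensurably
terminal — abc-iut-L3-d3's engine with the seven discharged facts supplied by name.
[cite: MochizukiSemiAnbd2006, Cor. 2.7(i) p.30] -/
theorem isCommensurablyTerminal_piHToPi_of_subgraphComponents_doubleCosets
    (hD3 : covering_subgraphComponents_doubleCosets.{v₁, u₁, u})
    (𝒢 : SemiGraphOfAnabelioids.{v₁, u₁, u}) (hc : 𝒢.IsConnected) (hg : 𝒢.IsGraphOfAnabelioids)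
    (hq : 𝒢.IsQuasiCoherent) (H : 𝒢.graph.Subgraph) (hH : H.toSemiGraph.IsConnected)
    (hHg : H.toSemiGraph.IsGraph) (hel : ∀ w : H.toSemiGraph.Vertex, 𝒢.IsElevated w.1)
    (v : 𝒢.graph.Vertex) (hvH : v ∈ H.verts) (F : 𝒢.V v ⥤ FintypeCat.{v₁}) [FiberFunctor F] :
    AbsoluteAnabelian.IsCommensurablyTerminal (𝒢.piHToPi H ⟨v, hvH⟩ F).range :=
  isCommensurablyTerminal_piHToPi_of_dictionary proposition_2_6_holds
    exists_finiteEtaleCoveringGlobal_holds covering_decompositionGroup_holds hD3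
    covering_isQuasiCoherent_holds covering_isElevated_holds covering_isConnected_holds
    covering_vertexMap_surjective_holds 𝒢 hc hg hq H hH hHg hel v hvH F

/-- **[SemiAnbd] Rmk. 2.7.2, modulo (D3) alone**: commensurable terminality of the subgroups `J` with
`Π_v ≥ J` open in an elevated verticial subgroup (abc-iut-L3-d1's formal reduction to Cor. 2.7 (i)).
[cite: MochizukiSemiAnbd2006, Rem. 2.7.2 p.30] -/
theorem remark_2_7_2_of_subgraphComponents_doubleCosets
    (hD3 : covering_subgraphComponents_doubleCosets.{v₁, u₁, u}) : remark_2_7_2.{v₁, u₁, u} :=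
  remark_2_7_2_of_corollary_2_7_i (corollary_2_7_i_of_subgraphComponents_doubleCosets hD3)

/-- **[SemiAnbd] Cor. 2.7 (ii), modulo (D3) and Prop. 2.5 (i)**: relative slimness consequences
(abc-iut-L3-d1's reduction `corollary_2_7_ii_of_corollary_2_7_i`, whose other input is the named fact
`proposition_2_5_i`). [cite: MochizukiSemiAnbd2006, Cor. 2.7(ii) p.30] -/
theorem corollary_2_7_ii_of_prop25i_subgraphComponents_doubleCosets
    (h25 : proposition_2_5_i.{v₁, u₁, u})
    (hD3 : covering_subgraphComponents_doubleCosets.{v₁, u₁, u}) : corollary_2_7_ii.{v₁, u₁, u} :=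
  corollary_2_7_ii_of_corollary_2_7_i h25 (corollary_2_7_i_of_subgraphComponents_doubleCosets hD3)

end SemiGraphOfAnabelioids

end Literature.AnabelianGeometry.SemiGraphs
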